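import Summits.ABC.IUTFork.Conditional.AbcOfSHregRadicalEpsilon
import HarnessLib

/-!
# Branch C, TARGET #1: v3's CONE binder `hvol` ⟹ `rad((4^{m+1}+1)(4^m+1)) ≥ 4^{(1/3 − ε)(m+1)}` for all large `m`
# (abc-iut cell, R2 S-chain team, seat abc-iut-s2-p3 gen 2; the `hvol` twin of `AbcOfSHregRadicalEpsilon`)

Record-only PROOF file (D-0012) of the abc-iut cell; TAKES NO SIDE on [IUTchIII] Cor. 3.12 or [IUTchIV] Thm. 1.10.
S. Mochizuki, *IUT IV* [Mochizuki2012], Thm. 1.10 pp. 22–31 [claim: Mochizuki2012, status: disputed] for the IUT quotation; the content of THIS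
file is two compositions.

`Conditional.abc_of_S_v3` (p430884) carries the CONE binder `hvol : ∀ P ∈ UP, ∀ l prime ≥ 5, AdmitsCore → CondP2 → CondP5 → CondP6 →
Cor22.HullVolumeAtDatum P l B_III(P,l)`; v4/v5K/v6K/v7K carry `hreg` = the same estimate demanded only OFF the slot-constant regime, so
`hvol ⟹ hreg` by dropping a premise (`Conditional.hreg_of_hvol`, a one-liner recorded here for the by-name bookkeeping of the SCOREBOARD).
Hence the explicit radical consequence of `hreg` (`Conditional.log_radical_ge_of_hreg`, p447879) is a consequence of `hvol` too:

* `Conditional.hreg_of_hvol` — `hvol ⟹ hreg` (premise dropped; both binder types VERBATIM);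
* **`Conditional.log_radical_ge_of_hvol`**, **`Conditional.radical_ge_rpow_of_hvol`** — `hvol` ⟹ for every `ε > 0` there is `m₁` with
  `4^{(1/3 − ε)(m+1)} ≤ rad((4^{m+1}+1)·(4^m+1))` for all `m ≥ m₁`.

HONEST SCOPE: consequences of the typed binder; nothing asserted about print or any author; nothing here asserts abc, `hvol` or `hreg`;
typed ≠ proved; no side taken. PROOF-ONLY file: no definitions. [cite: Mochizuki2012, IUTchIV Thm. 1.10 pp. 22–31]
-/

noncomputable section

namespace Summit.ABC.IUTFork

open NumberField IsDedekindDomain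
open Literature.IUT.HodgeTheaters Literature.IUT.LogVolume Literature.IUT.LogVolume.Cor22
open Literature.NumberTheory.DiophantineGeometry Literature.NumberTheory.DiophantineGeometry.GenEll
open scoped Classical

namespace Conditional

/-- **`hvol ⟹ hreg`**: v4's CONE binder (the hull estimate demanded only at non-slot-constant data) follows from v3's (demanded at all data)
by dropping the regime premise. Both binder types VERBATIM (`Conditional.abc_of_S_v3` p430884 / `abc_of_S_v4` p431657 = v6K p437297).
[cite: Mochizuki2012, IUTchIV Thm. 1.10 Step (v) p. 27–28] [claim: Mochizuki2012, status: disputed] -/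
theorem hreg_of_hvol
    (hvol : ∀ P₀ : NFPoint, P₀ ∈ UP → ∀ l : ℕ, l.Prime → 5 ≤ l →
      Cor22.AdmitsCore P₀ → Cor22.CondP2 P₀ l → Cor22.CondP5 P₀ l → Cor22.CondP6 P₀ l →
        Cor22.HullVolumeAtDatum P₀ l (((l : ℝ) + 1) / 4 *
          ((1 + 12 * (Cor22.dmod P₀ : ℝ) / l) * (P₀.logDiff + Cor22.logCondAvoid P₀ {2, l})
            + 2 * Real.log l + 52
            + 20 / 3 * Real.log (((2 ^ 12 * 3 ^ 3 * 5 * Cor22.dmod P₀ : ℕ) : ℝ) * (l : ℝ))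
              * (Nat.primeCounting (2 ^ 12 * 3 ^ 3 * 5 * Cor22.dmod P₀ * l) : ℝ)))) :
    ∀ P : NFPoint, P ∈ UP → ∀ l : ℕ, l.Prime → 5 ≤ l →
      Cor22.AdmitsCore P → Cor22.CondP2 P l → Cor22.CondP5 P l → Cor22.CondP6 P l →
      ∀ T : Cor22.ThetaVolumeDatumAt P l,
        (letI := T.instFieldF; letI := T.instNumberFieldF; letI := T.instAlgebraF; letI := T.instFieldK
         letI := T.instNumberFieldK; letI := T.instAlgebraK; letI := T.instFieldFbar; letI := T.instAlgebraFbar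
         letI := T.instAlgebraKFbar; letI := T.instIsElliptic
         ¬ (∀ p ∈ T.I.supportPrimes, ∀ v w : placesOver (fieldOfModuli T.E) p,
            (Summit.ABC.IUTFork.DHData.ofInput T.I).logQloc p v = (Summit.ABC.IUTFork.DHData.ofInput T.I).logQloc p w)) →
        T.HullEstimateOf
          (((l : ℝ) + 1) / 4 *
            ((1 + 12 * (Cor22.dmod P : ℝ) / l) * (P.logDiff + Cor22.logCondAvoid P {2, l})
              + 2 * Real.log l + 52
              + 20 / 3 * Real.log (((2 ^ 12 * 3 ^ 3 * 5 * Cor22.dmod P : ℕ) : ℝ) * (l : ℝ))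
                * (Nat.primeCounting (2 ^ 12 * 3 ^ 3 * 5 * Cor22.dmod P * l) : ℝ))) :=
  fun P hP l hl h5 hc h2 h5' h6 T _ => hvol P hP l hl h5 hc h2 h5' h6 T

/-- **v3's CONE binder `hvol` ⟹ `(1/3 − ε)(m+1)·log 4 ≤ log rad((4^{m+1}+1)(4^m+1))` for all large `m`** (`hreg_of_hvol` then
`log_radical_ge_of_hreg`). Nothing asserted about print or about any author; nothing here asserts `hvol`; no side taken.
[cite: Mochizuki2012, IUTchIV Thm. 1.10 pp. 22–31] [claim: Mochizuki2012, status: disputed] -/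
theorem log_radical_ge_of_hvol
    (hvol : ∀ P₀ : NFPoint, P₀ ∈ UP → ∀ l : ℕ, l.Prime → 5 ≤ l →
      Cor22.AdmitsCore P₀ → Cor22.CondP2 P₀ l → Cor22.CondP5 P₀ l → Cor22.CondP6 P₀ l →
        Cor22.HullVolumeAtDatum P₀ l (((l : ℝ) + 1) / 4 *
          ((1 + 12 * (Cor22.dmod P₀ : ℝ) / l) * (P₀.logDiff + Cor22.logCondAvoid P₀ {2, l})
            + 2 * Real.log l + 52
            + 20 / 3 * Real.log (((2 ^ 12 * 3 ^ 3 * 5 * Cor22.dmod P₀ : ℕ) : ℝ) * (l : ℝ))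
              * (Nat.primeCounting (2 ^ 12 * 3 ^ 3 * 5 * Cor22.dmod P₀ * l) : ℝ))))
    {ε : ℝ} (hε : 0 < ε) :
    ∃ m₁ : ℕ, ∀ m : ℕ, m₁ ≤ m →
      (1 / 3 - ε) * ((m : ℝ) + 1) * Real.log 4 ≤
        Real.log (UniqueFactorizationMonoid.radical ((4 ^ (m + 1) + 1) * (4 ^ m + 1)) : ℕ) :=
  log_radical_ge_of_hreg (hreg_of_hvol hvol) hε

/-- **v3's CONE binder `hvol` ⟹ `4^{(1/3 − ε)(m+1)} ≤ rad((4^{m+1}+1)(4^m+1))` for all large `m`** (`^` = `Real.rpow`). Nothing asserted about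
print or about any author; nothing here asserts `hvol` or abc; no side taken. [cite: Mochizuki2012, IUTchIV Thm. 1.10 pp. 22–31]
[claim: Mochizuki2012, status: disputed] -/
theorem radical_ge_rpow_of_hvol
    (hvol : ∀ P₀ : NFPoint, P₀ ∈ UP → ∀ l : ℕ, l.Prime → 5 ≤ l →
      Cor22.AdmitsCore P₀ → Cor22.CondP2 P₀ l → Cor22.CondP5 P₀ l → Cor22.CondP6 P₀ l →
        Cor22.HullVolumeAtDatum P₀ l (((l : ℝ) + 1) / 4 *
          ((1 + 12 * (Cor22.dmod P₀ : ℝ) / l) * (P₀.logDiff + Cor22.logCondAvoid P₀ {2, l})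
            + 2 * Real.log l + 52
            + 20 / 3 * Real.log (((2 ^ 12 * 3 ^ 3 * 5 * Cor22.dmod P₀ : ℕ) : ℝ) * (l : ℝ))
              * (Nat.primeCounting (2 ^ 12 * 3 ^ 3 * 5 * Cor22.dmod P₀ * l) : ℝ))))
    {ε : ℝ} (hε : 0 < ε) :
    ∃ m₁ : ℕ, ∀ m : ℕ, m₁ ≤ m →
      (4 : ℝ) ^ ((1 / 3 - ε) * ((m : ℝ) + 1)) ≤ (UniqueFactorizationMonoid.radical ((4 ^ (m + 1) + 1) * (4 ^ m + 1)) : ℕ) :=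
  radical_ge_rpow_of_hreg (hreg_of_hvol hvol) hε

end Conditional

end Summit.ABC.IUTFork

end
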